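import Mathlib
import Literature.Barriers.NavierStokesRegularity.DyadicInvariantRegionNumerics
import Literature.Analysis.ODE.MaximalTime
import HarnessLib

/-!
# The invariant region of Barbato–Morandin–Romito (BMR 2011, Lemma 2.1): the dynamical argument

Barrier catalogue `Literature/Barriers/NavierStokesRegularity/`, proof file towards the named fact
`Dyadic.BarbatoMorandinRomito2011_thm1` (`DyadicCascadeRegularity`). We prove Lemma 2.1 of
Barbato–Morandin–Romito 2011 (§2, pp. 4–5 of the held arXiv text) for the rescaled truncated system
(BMR (e:YNeq)): in the variables `Yₙ = λₙ^{β-2+ε} Xₙ` the `N`-mode truncation reads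
`Ẏₙ = -νλₙ² Yₙ + λ^{β-4+2ε} λₙ^{2-ε} (Y_{n-1}² - λ^γ Yₙ Y_{n+1})`, `γ = 6 - 2β - 3ε`, with the
conventions `Y₀ = 0`, `Y_{N+1} = Y_N`, and the region
`A = {0 ≤ x ≤ 1, h(x) ≤ y ≤ g(x)}`, `g(x) = min(mx + θ, 1)`, `h(x) = c((x-δ)/(1-δ))^{λ²}` (`x > δ`),
`h(x) = 0` (`x ≤ δ`), `δ = 1/10`, `θ = 3/5`, `m = 3/4`, `λ^γ c = 1`, is invariant for all the pairs
`(Yₙ, Y_{n+1})`: **if `Yₙ(0) ∈ [0, δ]` for all `n ≤ N` then `Yₙ(t) ≤ 1` for all `t ≥ 0`**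
(`invariantRegion_le_one`; we only export the consequence used in the proof of Thm. 1, §3.2:
"Lemma 2.1 ensures that `Yₙ^{(N)}(t) ≤ 1`").

## Statement and proof as formalised

The lemma is stated for an abstract nearest-neighbour system
`Ẏₙ = -κₙ Yₙ + Fₙ (Y_{n-1}² - p Yₙ Y_{n+1})` (`1 ≤ n ≤ N`) with `0 < κₙ ≤ κ_{n+1} ≤ 4κₙ`,
`Fₙ > 0`, `F_{n+1} = L Fₙ`, `p c = 1`, `0 < p ≤ L`, `c ≤ 1` and the three numerical relations
`L ≥ 4·0.993`, `c ≤ 1.022/2`, `Lc ≤ 2·1.015` — exactly what BMR's field satisfies for `λ = 2`,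
`β ∈ (2, 5/2]`, `ε ∈ (0, 1/100]` (`κₙ = νλₙ²`, `Fₙ = λ^{β-4+2ε}λₙ^{2-ε}`, `L = λ^{2-ε}`, `p = λ^γ`;
the instantiation is `DyadicInvariantRegionScaling.lean`). The solution is any family of continuous
non-negative functions with the displayed right derivatives (non-negativity is an input: for the
dyadic system it is Cheskidov's positivity, `DyadicCascadePositivity`). BMR argue that the field
points inward on the six pieces of `∂A` ("it is sufficient to show that the derivative in time of
`(Yₙ, Y_{n+1})` points inward on the border of `A`"); several of their inequalities are equalities
(the left and bottom-left pieces are exactly the positivity of the modes, and `λ^γ c = 1` makes the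
inviscid part vanish at the corner `(1, c)`), so the formal proof is a first-exit argument
(`Literature.Analysis.ODE.maximalTimeP`) for the closed constraints
`Yₙ ≤ 1`, `Y_{n+1} ≤ mYₙ + θ`, `h(Yₙ) ≤ Y_{n+1}` in which, at the exit time, each active constraint
is shown to persist to the right: either its time derivative is strictly negative (right and top
pieces: strictly thanks to `ν > 0`; slanted piece: BMR (2.2), `top_slant_ineq`; curved bottom piece:
BMR (2.3), `bottom_curve_ineq`), or — on the flat bottom piece `x < δ`, where `h ≡ 0` — it is
positivity. We need `ν > 0` (BMR state `ν ≥ 0`; Thm. 1 uses `ν̄ = δν/K₀ > 0`).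

Theorem-only module (no definitions; the curve `h` is written out as a lambda).

## References

* D. Barbato, F. Morandin, M. Romito, *Smooth solutions for the dyadic model*, Nonlinearity 24
  (2011) 3083–3097, §2, (e:Yeq), (e:YNeq), Lemma 2.1 and its proof, (2.2)–(2.3)
  (arXiv:1007.3401, pp. 4–5). [`BarbatoMorandinRomito2011`]
-/

noncomputable section

open Set Filter Topology

namespace Literature.Barriers.NavierStokesRegularity.Dyadic

/-! ## One-sided filter lemmas for first-exit arguments -/

/-- A function with a strictly negative right derivative at `τ` and `φ(τ) ≤ 0` stays `≤ 0`
immediately to the right of `τ`. [folklore] -/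
theorem eventually_nonpos_of_hasDerivWithinAt_neg {φ : ℝ → ℝ} {φ' τ : ℝ}
    (h : HasDerivWithinAt φ φ' (Ici τ) τ) (hneg : φ' < 0) (h0 : φ τ ≤ 0) :
    ∀ᶠ t in 𝓝[Ici τ] τ, φ t ≤ 0 := by
  have h' : HasDerivWithinAt φ φ' (Ioi τ) τ := h.mono Ioi_subset_Ici_self
  rw [hasDerivWithinAt_iff_tendsto_slope' (show τ ∉ Ioi τ from lt_irrefl τ)] at h'
  have h2 : ∀ᶠ t in 𝓝[Ioi τ] τ, slope φ τ t < 0 := h'.eventually_lt_const hneg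
  have h3 : ∀ᶠ t in 𝓝[Ioi τ] τ, φ t ≤ 0 := by
    filter_upwards [h2, self_mem_nhdsWithin] with t ht hτt
    rw [slope_def_field] at ht
    have hpos : 0 < t - τ := sub_pos.2 hτt
    have : φ t - φ τ < 0 := by
      by_contra hc
      push Not at hc
      exact absurd ht (not_lt.2 (div_nonneg hc hpos.le))
    linarith
  rw [← Ioi_insert, nhdsWithin_insert, eventually_sup]
  exact ⟨eventually_pure.2 h0, h3⟩

/-- If `P` holds on `[a, τ]` and eventually to the right of `τ`, then `P` holds eventually at `τ`
within `[a, b]`. [folklore] -/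
theorem eventually_nhdsWithin_Icc_of_left_of_right {P : ℝ → Prop} {a b τ : ℝ}
    (hleft : ∀ t ∈ Icc a τ, P t) (hright : ∀ᶠ t in 𝓝[Ici τ] τ, P t) :
    ∀ᶠ t in 𝓝[Icc a b] τ, P t := by
  obtain ⟨u, hu, hsub⟩ := mem_nhdsGE_iff_exists_Ico_subset.1 hright
  have hmem : Icc a b ∩ Iio u ∈ 𝓝[Icc a b] τ := inter_mem_nhdsWithin _ (Iio_mem_nhds hu)
  filter_upwards [hmem] with t ht
  rcases le_or_gt t τ with h | h
  · exact hleft t ⟨ht.1.1, h⟩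
  · exact hsub ⟨h.le, ht.2⟩

/-- Closed constraints pass to limits from the left: if `f, g` are continuous on `[a, b]`,
`t ∈ (a, b]` and `f ≤ g` on `[a, t)`, then `f t ≤ g t`. [folklore] -/
theorem le_of_forall_Ico_le {f g : ℝ → ℝ} {a b t : ℝ} (hf : ContinuousOn f (Icc a b))
    (hg : ContinuousOn g (Icc a b)) (ht : t ∈ Ioc a b) (h : ∀ s ∈ Ico a t, f s ≤ g s) :
    f t ≤ g t := by
  have htc : t ∈ closure (Ico a t) := by
    rw [closure_Ico ht.1.ne]; exact right_mem_Icc.2 ht.1.le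
  have hsub : Ico a t ⊆ Icc a b := fun s hs => ⟨hs.1, hs.2.le.trans ht.2⟩
  exact ((hf t ⟨ht.1.le, ht.2⟩).mono hsub).closure_le htc ((hg t ⟨ht.1.le, ht.2⟩).mono hsub) h

/-! ## The lower curve `h` and its derivative -/

/-- **The lower curve is `C¹`.** `h(y) = c((y-δ)/(1-δ))⁴` for `y > δ`, `0` for `y ≤ δ`
(`δ = 1/10`), has derivative `h'(y) = 4c((y-δ)/(1-δ))³/(1-δ)` for `y > δ` and `0` for `y ≤ δ`
at every point (the two branches match to first order at `δ`). [cite: BarbatoMorandinRomito2011, §2 (definition of `h`)] -/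
theorem hasDerivAt_lowerCurve (c y : ℝ) :
    HasDerivAt (fun x : ℝ => if x ≤ 1 / 10 then (0 : ℝ) else c * ((x - 1 / 10) / (9 / 10)) ^ 4)
      (if y ≤ 1 / 10 then (0 : ℝ) else 4 * c * ((y - 1 / 10) / (9 / 10)) ^ 3 / (9 / 10)) y := by
  -- the smooth branch
  have hq : ∀ x : ℝ, HasDerivAt (fun x : ℝ => c * ((x - 1 / 10) / (9 / 10)) ^ 4)
      (4 * c * ((x - 1 / 10) / (9 / 10)) ^ 3 / (9 / 10)) x := by
    intro x
    have h1 : HasDerivAt (fun x : ℝ => (x - 1 / 10) / (9 / 10)) (1 / (9 / 10)) x := by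
      simpa using ((hasDerivAt_id x).sub_const (1 / 10 : ℝ)).div_const (9 / 10 : ℝ)
    have h2 := (h1.pow 4).const_mul c
    refine h2.congr_deriv ?_
    push_cast
    ring
  rcases lt_trichotomy y (1 / 10) with hy | hy | hy
  · -- left of `δ`: locally zero
    have hev : (fun x : ℝ => if x ≤ 1 / 10 then (0 : ℝ) else c * ((x - 1 / 10) / (9 / 10)) ^ 4) =ᶠ[𝓝 y]
        fun _ => 0 := by
      filter_upwards [Iio_mem_nhds hy] with x hx
      rw [if_pos (le_of_lt hx)]
    rw [if_pos hy.le]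
    exact (hasDerivAt_const y (0 : ℝ)).congr_of_eventuallyEq hev
  · -- at `δ`: glue the two one-sided derivatives, both zero
    subst hy
    rw [if_pos le_rfl]
    have hl : HasDerivWithinAt
        (fun x : ℝ => if x ≤ 1 / 10 then (0 : ℝ) else c * ((x - 1 / 10) / (9 / 10)) ^ 4) 0
        (Iic (1 / 10)) (1 / 10) :=
      (hasDerivWithinAt_const _ _ (0 : ℝ)).congr (fun x (hx : x ≤ 1 / 10) => by rw [if_pos hx])
        (by rw [if_pos le_rfl])
    have hr : HasDerivWithinAt
        (fun x : ℝ => if x ≤ 1 / 10 then (0 : ℝ) else c * ((x - 1 / 10) / (9 / 10)) ^ 4) 0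
        (Ici (1 / 10)) (1 / 10) := by
      have h0 : (4 * c * (((1 : ℝ) / 10 - 1 / 10) / (9 / 10)) ^ 3 / (9 / 10)) = 0 := by norm_num
      have := (hq (1 / 10)).hasDerivWithinAt (s := Ici (1 / 10))
      rw [h0] at this
      refine this.congr (fun x (hx : 1 / 10 ≤ x) => ?_) (by norm_num)
      rcases eq_or_lt_of_le hx with rfl | hlt
      · norm_num
      · rw [if_neg (not_le.2 hlt)]
    have := hl.union hr
    rwa [Iic_union_Ici, hasDerivWithinAt_univ] at this
  · -- right of `δ`: locally the smooth branch
    have hev : (fun x : ℝ => if x ≤ 1 / 10 then (0 : ℝ) else c * ((x - 1 / 10) / (9 / 10)) ^ 4) =ᶠ[𝓝 y]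
        fun x => c * ((x - 1 / 10) / (9 / 10)) ^ 4 := by
      filter_upwards [Ioi_mem_nhds hy] with x hx
      rw [if_neg (not_le.2 hx)]
    rw [if_neg (not_le.2 hy)]
    exact (hq y).congr_of_eventuallyEq hev

/-- The lower curve is continuous. [cite: BarbatoMorandinRomito2011, §2 (definition of `h`)] -/
theorem continuous_lowerCurve (c : ℝ) :
    Continuous (fun x : ℝ => if x ≤ 1 / 10 then (0 : ℝ) else c * ((x - 1 / 10) / (9 / 10)) ^ 4) :=
  continuous_iff_continuousAt.2 fun y => (hasDerivAt_lowerCurve c y).continuousAt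

/-! ## Inward pointing on the pieces of the boundary (pure inequalities) -/

/-- **Right piece `x = 1` (and top piece `y = 1`)**: at a mode sitting at `1`, with the mode below
in `[0, 1]` and the mode above at least `c`, the right-hand side is `≤ -κ < 0` because `p c = 1`
(BMR: `𝔅ᵥ·n₄ = 1 > 0`, `𝔅ᵢ·n₄ = λ^γ x Y_{n+1} - Y_{n-1}² ≥ λ^γ c - 1 = 0`; the strictness comes
from the viscosity). [cite: BarbatoMorandinRomito2011, §2 Lemma 2.1 (proof, pieces n₃, n₄)] -/
theorem rhs_neg_at_one {κ F p c w z : ℝ} (hκ : 0 < κ) (hF : 0 ≤ F) (hp : 0 ≤ p) (hpc : p * c = 1)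
    (hw0 : 0 ≤ w) (hw1 : w ≤ 1) (hz : c ≤ z) :
    -κ * 1 + F * (w ^ 2 - p * 1 * z) < 0 := by
  have h1 : w ^ 2 ≤ 1 := by nlinarith
  have h2 : 1 ≤ p * z := by nlinarith [mul_le_mul_of_nonneg_left hz hp]
  nlinarith [mul_nonneg hF (by linarith : 0 ≤ p * 1 * z - w ^ 2)]

/-- **Slanted top piece `y = mx + θ`**: the derivative of `Y_{n+1} - mYₙ - θ` is strictly
negative there. Viscous part: `-κ_{n+1}y + mκₙx ≤ -κₙ(y - mx) = -κₙθ·… < 0`; inviscid part `≤ 0`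
by `z ≥ h(y)`, `p c = 1`, `p ≤ L` and `ψ₁ ≥ 0` (`top_slant_ineq`).
[cite: BarbatoMorandinRomito2011, §2 Lemma 2.1 (proof, piece n₂, (2.2))] -/
theorem top_slant_deriv_neg {κn κn1 Fn L p c x y z w : ℝ} (hκn : 0 < κn) (hκmono : κn ≤ κn1)
    (hFn : 0 < Fn) (hp : 0 < p) (hpL : p ≤ L) (hpc : p * c = 1) (hx : 0 ≤ x)
    (hy : y = 3 / 4 * x + 3 / 5) (hy1 : y ≤ 1)
    (hz : c * ((y - 1 / 10) / (9 / 10)) ^ 4 ≤ z) :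
    (-κn1 * y + L * Fn * (x ^ 2 - p * y * z)) - 3 / 4 * (-κn * x + Fn * (w ^ 2 - p * x * y)) < 0 := by
  have hy0 : 0 < y := by rw [hy]; positivity
  have hL : 0 < L := hp.trans_le hpL
  -- viscous part
  have hv : -κn1 * y + 3 / 4 * (κn * x) < 0 := by
    have : κn * y ≤ κn1 * y := mul_le_mul_of_nonneg_right hκmono hy0.le
    rw [hy] at this ⊢
    nlinarith
  -- inviscid part: `L (x² - p y z) + (3/4) p x y ≤ 0`, dropping `-w²`
  have hψ := top_slant_ineq hx hy hy1
  have hu4 : y * ((y - 1 / 10) / (9 / 10)) ^ 4 ≤ p * y * z := by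
    have := mul_le_mul_of_nonneg_left hz (mul_nonneg hp.le hy0.le)
    calc y * ((y - 1 / 10) / (9 / 10)) ^ 4 = p * y * (c * ((y - 1 / 10) / (9 / 10)) ^ 4) := by
          rw [show p * y * (c * ((y - 1 / 10) / (9 / 10)) ^ 4) =
            (p * c) * (y * ((y - 1 / 10) / (9 / 10)) ^ 4) by ring, hpc, one_mul]
      _ ≤ p * y * z := this
  have hi : L * (x ^ 2 - p * y * z) + 3 / 4 * (p * x * y) ≤ 0 := by
    have h1 : L * (x ^ 2 - p * y * z) ≤ L * (x ^ 2 - y * ((y - 1 / 10) / (9 / 10)) ^ 4) := by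
      apply mul_le_mul_of_nonneg_left _ hL.le; linarith
    have h2 : 3 / 4 * (p * x * y) ≤ 3 / 4 * (L * x * y) := by
      have := mul_le_mul_of_nonneg_right hpL (mul_nonneg hx hy0.le)
      nlinarith
    have h3 : L * (x ^ 2 - y * ((y - 1 / 10) / (9 / 10)) ^ 4) + 3 / 4 * (L * x * y) ≤ 0 := by
      have : L * (x ^ 2 + 3 / 4 * x * y - y * ((y - 1 / 10) / (9 / 10)) ^ 4) ≤ 0 :=
        mul_nonpos_of_nonneg_of_nonpos hL.le (by linarith)
      linarith
    linarith
  have hw : 0 ≤ Fn * w ^ 2 := mul_nonneg hFn.le (sq_nonneg w)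
  have key : (-κn1 * y + L * Fn * (x ^ 2 - p * y * z)) - 3 / 4 * (-κn * x + Fn * (w ^ 2 - p * x * y)) =
      (-κn1 * y + 3 / 4 * (κn * x)) + Fn * (L * (x ^ 2 - p * y * z) + 3 / 4 * (p * x * y)) -
        3 / 4 * (Fn * w ^ 2) := by ring
  rw [key]
  nlinarith [mul_nonpos_of_nonneg_of_nonpos hFn.le hi]

/-- **Curved bottom piece `y = h(x)`, `x > δ`**: the derivative of `h(Yₙ) - Y_{n+1}` is strictly
negative there. Viscous part `≤ 0` since `x h'(x) - λ²h(x) ≥ 0` and `κ_{n+1} ≤ 4κₙ`; inviscid part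
`< 0` by `z ≤ m y + θ`, `w² ≤ 1`, `p c = 1` and BMR (2.3) (`bottom_curve_ineq`).
[cite: BarbatoMorandinRomito2011, §2 Lemma 2.1 (proof, piece n₅, (2.3))] -/
theorem bottom_curve_deriv_neg {κn κn1 Fn L p c x y z w : ℝ} (hκn : 0 ≤ κn) (hκ4 : κn1 ≤ 4 * κn)
    (hFn : 0 < Fn) (hp : 0 < p) (hpc : p * c = 1) (hL : 4 * 0.993 ≤ L) (hcb : c ≤ 1.022 / 2)
    (hLc : L * c ≤ 2 * 1.015) (hx0 : 1 / 10 ≤ x) (hx1 : x ≤ 1)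
    (hy : y = c * ((x - 1 / 10) / (9 / 10)) ^ 4) (hz : z ≤ 3 / 4 * y + 3 / 5)
    (hw0 : 0 ≤ w) (hw1 : w ≤ 1) :
    4 * c * ((x - 1 / 10) / (9 / 10)) ^ 3 / (9 / 10) * (-κn * x + Fn * (w ^ 2 - p * x * y)) -
      (-κn1 * y + L * Fn * (x ^ 2 - p * y * z)) < 0 := by
  have hc0 : 0 < c := by
    have : 0 < p * c := by rw [hpc]; exact one_pos
    exact pos_of_mul_pos_right this hp.le
  set u : ℝ := (x - 1 / 10) / (9 / 10) with hu
  obtain ⟨hu0, hu1⟩ := sub_delta_div_mem hx0 hx1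
  have hy0 : 0 ≤ y := by rw [hy]; positivity
  have hu3 : 0 ≤ u ^ 3 := pow_nonneg hu0 3
  -- viscous part: `h'(x) κₙ x ≥ 4 κₙ h(x) ≥ κ_{n+1} h(x)`
  have hv : 0 ≤ 4 * c * u ^ 3 / (9 / 10) * (κn * x) - κn1 * y := by
    have hxu : x / (9 / 10) = u + (1 / 10) / (9 / 10) := by rw [hu]; ring
    have h1 : 4 * c * u ^ 3 / (9 / 10) * (κn * x) = 4 * κn * (c * u ^ 3) * (x / (9 / 10)) := by ring
    have h2 : κn1 * y ≤ 4 * κn * y := mul_le_mul_of_nonneg_right hκ4 hy0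
    have h3 : 4 * κn * y ≤ 4 * κn * (c * u ^ 3) * (x / (9 / 10)) := by
      rw [hy, hxu]
      have : c * u ^ 4 ≤ c * u ^ 3 * (u + 1 / 10 / (9 / 10)) := by
        have : (0 : ℝ) ≤ c * u ^ 3 * (1 / 10 / (9 / 10)) := by positivity
        nlinarith
      have := mul_le_mul_of_nonneg_left this (by positivity : (0 : ℝ) ≤ 4 * κn)
      linarith [this]
    linarith
  -- inviscid part
  have hyu : p * y = u ^ 4 := by
    rw [hy, show p * (c * u ^ 4) = (p * c) * u ^ 4 by ring, hpc, one_mul]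
  have hxy : p * x * y = x * u ^ 4 := by rw [mul_comm p x, mul_assoc, hyu]
  have hB : 0 ≤ 1 - x * u ^ 4 := by
    have : u ^ 4 ≤ 1 := pow_le_one₀ hu0 hu1
    nlinarith [pow_nonneg hu0 4]
  have hnum := bottom_curve_ineq (C := c) hx0 hx1 hL hcb hLc
  -- replace `z` and `w` by their bounds
  have h1 : x ^ 2 - u ^ 4 * (3 / 4 * c * u ^ 4 + 3 / 5) ≤ x ^ 2 - p * y * z := by
    have : p * y * z ≤ u ^ 4 * (3 / 4 * y + 3 / 5) := by
      rw [hyu]; exact mul_le_mul_of_nonneg_left hz (pow_nonneg hu0 4)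
    have hyc : u ^ 4 * (3 / 4 * y + 3 / 5) = u ^ 4 * (3 / 4 * c * u ^ 4 + 3 / 5) := by rw [hy]; ring
    linarith
  have h2 : w ^ 2 - p * x * y ≤ 1 - x * u ^ 4 := by rw [hxy]; nlinarith
  have hFL : 0 ≤ L * Fn := mul_nonneg (by linarith) hFn.le
  have hhd : 0 ≤ 4 * c * u ^ 3 / (9 / 10) := by positivity
  have key : 4 * c * u ^ 3 / (9 / 10) * (-κn * x + Fn * (w ^ 2 - p * x * y)) -
      (-κn1 * y + L * Fn * (x ^ 2 - p * y * z)) =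
      -(4 * c * u ^ 3 / (9 / 10) * (κn * x) - κn1 * y) -
        Fn * (L * (x ^ 2 - p * y * z) - 4 * c / (9 / 10) * u ^ 3 * (w ^ 2 - p * x * y)) := by ring
  rw [key]
  have h3 : L * (x ^ 2 - u ^ 4 * (3 / 4 * c * u ^ 4 + 3 / 5)) - 4 * c / (9 / 10) * u ^ 3 * (1 - x * u ^ 4) ≤
      L * (x ^ 2 - p * y * z) - 4 * c / (9 / 10) * u ^ 3 * (w ^ 2 - p * x * y) := by
    have e1 := mul_le_mul_of_nonneg_left h1 (by linarith : (0 : ℝ) ≤ L)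
    have e2 := mul_le_mul_of_nonneg_left h2 (by positivity : (0 : ℝ) ≤ 4 * c / (9 / 10) * u ^ 3)
    linarith
  have h4 : 0 < L * (x ^ 2 - p * y * z) - 4 * c / (9 / 10) * u ^ 3 * (w ^ 2 - p * x * y) :=
    hnum.trans_le h3
  nlinarith [mul_pos hFn h4]

/-- **Corner of the bottom piece, `x = δ`**: there `h(x) = h'(x) = 0`, so the derivative of
`h(Yₙ) - Y_{n+1}` is `-Ẏ_{n+1} = -F_{n+1} δ² < 0`. [cite: BarbatoMorandinRomito2011, §2 Lemma 2.1 (proof, piece n₅)] -/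
theorem bottom_corner_deriv_neg {κn1 Fn1 p z A : ℝ} (hF : 0 < Fn1) :
    0 * A - (-κn1 * 0 + Fn1 * ((1 / 10 : ℝ) ^ 2 - p * 0 * z)) < 0 := by
  nlinarith

end Literature.Barriers.NavierStokesRegularity.Dyadic

namespace Literature.Barriers.NavierStokesRegularity.Dyadic

/-! ## Lemma 2.1 -/

/-- **Barbato–Morandin–Romito 2011, Lemma 2.1 (the invariant region), abstract nearest-neighbour
form, exported consequence `Yₙ ≤ 1`.** Let `Y₀ = 0`, `Y_{N+1} = Y_N`, and let the continuous
non-negative functions `Y₁, …, Y_N` on `[0, ∞)` have right derivatives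
`Ẏₙ = -κₙYₙ + Fₙ(Y_{n-1}² - pYₙY_{n+1})` with `0 < κₙ ≤ κ_{n+1} ≤ 4κₙ`, `0 < Fₙ`, `F_{n+1} = LFₙ`,
`0 < p ≤ L`, `pc = 1`, `c ≤ 1`, `L ≥ 4·0.993`, `c ≤ 1.022/2`, `Lc ≤ 2·1.015` (for BMR's system
(e:YNeq): `κₙ = νλₙ²`, `Fₙ = λ^{β-4+2ε}λₙ^{2-ε}`, `L = λ^{2-ε}`, `p = λ^γ`, `c = λ^{-γ}`,
`γ = 6-2β-3ε`, valid for `λ = 2`, `β ∈ (2, 5/2]`, `ε ∈ (0, 1/100]`, `ν > 0`). If `Yₙ(0) ≤ δ = 1/10`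
for `1 ≤ n ≤ N`, then `Yₙ(t) ≤ 1` for all `t ≥ 0` and `1 ≤ n ≤ N`. Proof: the pairs
`(Yₙ, Y_{n+1})` start in BMR's region `A` (`[0, δ]² ⊆ A`) and never leave its closure — first-exit
argument on the constraints `Yₙ ≤ 1`, `Y_{n+1} ≤ mYₙ + θ`, `h(Yₙ) ≤ Y_{n+1}`, see the module
docstring. [cite: BarbatoMorandinRomito2011, §2 Lemma 2.1] -/
theorem invariantRegion_le_one {N : ℕ} {Y : ℕ → ℝ → ℝ} {κ F : ℕ → ℝ} {L p c : ℝ}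
    (hκ : ∀ n, 0 < κ n) (hκmono : ∀ n, κ n ≤ κ (n + 1)) (hκ4 : ∀ n, κ (n + 1) ≤ 4 * κ n)
    (hF : ∀ n, 0 < F n) (hFL : ∀ n, F (n + 1) = L * F n)
    (hp : 0 < p) (hpc : p * c = 1) (hpL : p ≤ L) (hc1 : c ≤ 1)
    (hL : 4 * 0.993 ≤ L) (hcb : c ≤ 1.022 / 2) (hLc : L * c ≤ 2 * 1.015)
    (hY0 : ∀ t, Y 0 t = 0) (hYN : ∀ t, Y (N + 1) t = Y N t)
    (hcont : ∀ n, n ≤ N → ContinuousOn (Y n) (Ici 0))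
    (hderiv : ∀ n, 1 ≤ n → n ≤ N → ∀ t, 0 ≤ t →
      HasDerivWithinAt (Y n) (-κ n * Y n t + F n * (Y (n - 1) t ^ 2 - p * Y n t * Y (n + 1) t))
        (Ici t) t)
    (hpos : ∀ n, n ≤ N + 1 → ∀ t, 0 ≤ t → 0 ≤ Y n t)
    (hinit : ∀ n, 1 ≤ n → n ≤ N → Y n 0 ≤ 1 / 10) :
    ∀ n, 1 ≤ n → n ≤ N → ∀ t, 0 ≤ t → Y n t ≤ 1 := by
  -- the lower curve
  set h : ℝ → ℝ := fun x => if x ≤ 1 / 10 then (0 : ℝ) else c * ((x - 1 / 10) / (9 / 10)) ^ 4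
    with hh
  have hcont' : ∀ n, n ≤ N + 1 → ContinuousOn (Y n) (Ici 0) := by
    intro n hn
    rcases Nat.lt_or_ge n (N + 1) with hlt | hge
    · exact hcont n (by omega)
    · have : n = N + 1 := le_antisymm hn hge
      subst this
      exact (hcont N le_rfl).congr fun t _ => hYN t
  -- the constraint predicate
  set P : ℝ → Prop := fun t =>
    (∀ n ∈ Finset.Icc 1 N, Y n t ≤ 1) ∧
      (∀ n ∈ Finset.Icc 1 (N - 1), Y (n + 1) t ≤ 3 / 4 * Y n t + 3 / 5) ∧
      (∀ n ∈ Finset.Icc 1 (N - 1), h (Y n t) ≤ Y (n + 1) t) with hP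
  suffices key : ∀ b, 0 < b → ∀ t ∈ Icc 0 b, P t by
    intro n hn1 hnN t ht
    have := key (t + 1) (by linarith) t ⟨ht, by linarith⟩
    simp only [hP] at this
    exact this.1 n (Finset.mem_Icc.2 ⟨hn1, hnN⟩)
  intro b hb
  have hmemI : ∀ {n}, n ∈ Finset.Icc 1 (N - 1) → 1 ≤ n ∧ n + 1 ≤ N := fun hn => by
    have := Finset.mem_Icc.1 hn; omega
  -- `P 0`
  have hP0 : P 0 := by
    simp only [hP]
    refine ⟨fun n hn => ?_, fun n hn => ?_, fun n hn => ?_⟩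
    · have := Finset.mem_Icc.1 hn
      linarith [hinit n this.1 this.2]
    · obtain ⟨hn1, hnN⟩ := hmemI hn
      have h1 := hinit (n + 1) (by omega) hnN
      have h2 := hpos n (by omega) 0 le_rfl
      linarith
    · obtain ⟨hn1, hnN⟩ := hmemI hn
      have h1 := hinit n hn1 (by omega)
      rw [hh]; dsimp only; rw [if_pos h1]
      exact hpos (n + 1) (by omega) 0 le_rfl
  -- the constraints are closed
  have hc_Icc : ∀ n, n ≤ N + 1 → ContinuousOn (Y n) (Icc 0 b) := fun n hn =>
    (hcont' n hn).mono Icc_subset_Ici_self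
  have hclosed : ∀ t ∈ Ioc 0 b, (∀ s ∈ Ico 0 t, P s) → P t := by
    intro t ht hPs
    simp only [hP] at hPs ⊢
    refine ⟨fun n hn => ?_, fun n hn => ?_, fun n hn => ?_⟩
    · have := Finset.mem_Icc.1 hn
      exact le_of_forall_Ico_le (hc_Icc n (by omega)) continuousOn_const ht
        fun s hs => (hPs s hs).1 n hn
    · obtain ⟨hn1, hnN⟩ := hmemI hn
      exact le_of_forall_Ico_le (hc_Icc (n + 1) (by omega))
        ((continuousOn_const.mul (hc_Icc n (by omega))).add continuousOn_const) ht
        fun s hs => (hPs s hs).2.1 n hn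
    · obtain ⟨hn1, hnN⟩ := hmemI hn
      exact le_of_forall_Ico_le ((continuous_lowerCurve c).comp_continuousOn (hc_Icc n (by omega)))
        (hc_Icc (n + 1) (by omega)) ht fun s hs => (hPs s hs).2.2 n hn
  -- the maximal time
  set T := Literature.Analysis.ODE.maximalTimeP P 0 b with hT
  have hTmem : T ∈ Icc 0 b := Literature.Analysis.ODE.maximalTimeP_mem hb.le hP0
  have hPT : ∀ t ∈ Icc 0 T, P t := fun t ht =>
    Literature.Analysis.ODE.maximalTimeP_spec hb.le hP0 hclosed ht
  by_contra hall
  have hTb : T < b := by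
    rcases lt_or_eq_of_le hTmem.2 with hlt | heq
    · exact hlt
    · exact absurd (fun t ht => hPT t (heq ▸ ht)) hall
  have hT0 : 0 ≤ T := hTmem.1
  -- the state at time `T`
  have hPτ := hPT T ⟨hT0, le_rfl⟩
  simp only [hP] at hPτ
  obtain ⟨hR, hTop, hBot⟩ := hPτ
  have hR' : ∀ k, 1 ≤ k → k ≤ N → Y k T ≤ 1 := fun k hk1 hkN =>
    hR k (Finset.mem_Icc.2 ⟨hk1, hkN⟩)
  have hle1 : ∀ k, k ≤ N + 1 → Y k T ≤ 1 := by
    intro k hk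
    rcases Nat.eq_zero_or_pos k with rfl | hk1
    · rw [hY0]; norm_num
    rcases Nat.lt_or_ge k (N + 1) with hlt | hge
    · exact hR' k hk1 (by omega)
    · have : k = N + 1 := le_antisymm hk hge
      subst this
      rw [hYN]
      rcases Nat.eq_zero_or_pos N with hN0 | hN1
      · subst hN0; rw [hY0]; norm_num
      · exact hR' N hN1 le_rfl
  have hTop' : ∀ k, 1 ≤ k → k + 1 ≤ N → Y (k + 1) T ≤ 3 / 4 * Y k T + 3 / 5 := fun k hk1 hkN =>
    hTop k (Finset.mem_Icc.2 ⟨hk1, by omega⟩)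
  have hBot' : ∀ k, 1 ≤ k → k + 1 ≤ N → h (Y k T) ≤ Y (k + 1) T := fun k hk1 hkN =>
    hBot k (Finset.mem_Icc.2 ⟨hk1, by omega⟩)
  have hposT : ∀ k, k ≤ N + 1 → 0 ≤ Y k T := fun k hk => hpos k hk T hT0
  -- the upper neighbour is at least `h` of the mode (also for the last, diagonal, pair)
  have hlow : ∀ k, 1 ≤ k → k ≤ N → 1 / 10 ≤ Y k T →
      c * ((Y k T - 1 / 10) / (9 / 10)) ^ 4 ≤ Y (k + 1) T := by
    intro k hk1 hkN hkδ
    rcases Nat.lt_or_ge k N with hlt | hge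
    · have := hBot' k hk1 hlt
      rw [hh] at this; dsimp only at this
      rcases eq_or_lt_of_le hkδ with heq | hgt
      · rw [← heq]; norm_num; exact hposT (k + 1) (by omega)
      · rwa [if_neg (not_le.2 hgt)] at this
    · have : k = N := le_antisymm hkN hge
      subst this
      rw [hYN]
      exact lower_curve_le_self hc1 hkδ (hR' k hk1 le_rfl)
  -- the upper neighbour is at most `m Y + θ` (also for the diagonal pair)
  have hupp : ∀ k, 1 ≤ k → k ≤ N → Y (k + 1) T ≤ 3 / 4 * Y k T + 3 / 5 := by
    intro k hk1 hkN
    rcases Nat.lt_or_ge k N with hlt | hge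
    · exact hTop' k hk1 hlt
    · have : k = N := le_antisymm hkN hge
      subst this
      rw [hYN]
      exact self_le_upper_line (hR' k hk1 le_rfl)
  -- continuity within `[T, ∞)` at `T`
  have hcw : ∀ k, k ≤ N + 1 → ContinuousWithinAt (Y k) (Ici T) T := fun k hk =>
    ((hcont' k hk) T hT0).mono (Ici_subset_Ici.2 hT0)
  -- derivatives at `T`
  have hd : ∀ k, 1 ≤ k → k ≤ N → HasDerivWithinAt (Y k)
      (-κ k * Y k T + F k * (Y (k - 1) T ^ 2 - p * Y k T * Y (k + 1) T)) (Ici T) T :=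
    fun k hk1 hkN => hderiv k hk1 hkN T hT0
  ------------------------------------------------------------------
  -- (R) the constraints `Yₙ ≤ 1` persist
  ------------------------------------------------------------------
  have evR : ∀ n ∈ Finset.Icc 1 N, ∀ᶠ t in 𝓝[Ici T] T, Y n t ≤ 1 := by
    intro n hn
    obtain ⟨hn1, hnN⟩ := Finset.mem_Icc.1 hn
    rcases lt_or_eq_of_le (hR' n hn1 hnN) with hlt | heq
    · exact ((hcw n (by omega)).eventually_lt_const hlt).mono fun t ht => ht.le
    · have hφ := (hd n hn1 hnN).sub_const 1
      have hz : c ≤ Y (n + 1) T := by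
        have := hlow n hn1 hnN (by rw [heq]; norm_num)
        rw [heq] at this
        norm_num at this
        exact this
      have hneg : -κ n * Y n T + F n * (Y (n - 1) T ^ 2 - p * Y n T * Y (n + 1) T) < 0 := by
        rw [heq]
        exact rhs_neg_at_one (hκ n) (hF n).le hp.le hpc (hposT (n - 1) (by omega))
          (hle1 (n - 1) (by omega)) hz
      exact (eventually_nonpos_of_hasDerivWithinAt_neg hφ hneg (by simp [heq])).mono
        fun t ht => by linarith
  ------------------------------------------------------------------
  -- (T) the constraints `Y_{n+1} ≤ m Yₙ + θ` persist
  ------------------------------------------------------------------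
  have evT : ∀ n ∈ Finset.Icc 1 (N - 1), ∀ᶠ t in 𝓝[Ici T] T,
      Y (n + 1) t ≤ 3 / 4 * Y n t + 3 / 5 := by
    intro n hn
    obtain ⟨hn1, hnN⟩ := hmemI hn
    rcases lt_or_eq_of_le (hTop' n hn1 hnN) with hlt | heq
    · have hc2 : ContinuousWithinAt (fun t => Y (n + 1) t - (3 / 4 * Y n t + 3 / 5)) (Ici T) T :=
        (hcw (n + 1) (by omega)).sub ((continuousWithinAt_const.mul (hcw n (by omega))).add
          continuousWithinAt_const)
      have hlt' : Y (n + 1) T - (3 / 4 * Y n T + 3 / 5) < 0 := by linarith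
      exact (hc2.eventually_lt_const hlt').mono
        fun t (ht : Y (n + 1) t - (3 / 4 * Y n t + 3 / 5) < 0) => by linarith
    · -- active constraint: the derivative is strictly negative (piece `n₂`)
      have hdn := hd n hn1 (by omega)
      have hdn1 := hd (n + 1) (by omega) hnN
      simp only [Nat.add_sub_cancel] at hdn1
      have hφ := hdn1.sub ((hdn.const_mul (3 / 4 : ℝ)).add_const (3 / 5 : ℝ))
      have hy1 : Y (n + 1) T ≤ 1 := hR' (n + 1) (by omega) hnN
      have hyδ : 1 / 10 ≤ Y (n + 1) T := by rw [heq]; linarith [hposT n (by omega)]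
      have hz := hlow (n + 1) (by omega) hnN hyδ
      have hneg : (-κ (n + 1) * Y (n + 1) T +
            F (n + 1) * (Y n T ^ 2 - p * Y (n + 1) T * Y (n + 1 + 1) T)) -
          3 / 4 * (-κ n * Y n T + F n * (Y (n - 1) T ^ 2 - p * Y n T * Y (n + 1) T)) < 0 := by
        rw [hFL n]
        have := top_slant_deriv_neg (hκ n) (hκmono n) (hF n) hp hpL hpc (hposT n (by omega))
          heq hy1 hz (w := Y (n - 1) T)
        convert this using 2
      have h0 : Y (n + 1) T - (3 / 4 * Y n T + 3 / 5) ≤ 0 := by linarith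
      exact (eventually_nonpos_of_hasDerivWithinAt_neg hφ hneg h0).mono
        fun t (ht : Y (n + 1) t - (3 / 4 * Y n t + 3 / 5) ≤ 0) => by linarith
  ------------------------------------------------------------------
  -- (B) the constraints `h(Yₙ) ≤ Y_{n+1}` persist
  ------------------------------------------------------------------
  have evB : ∀ n ∈ Finset.Icc 1 (N - 1), ∀ᶠ t in 𝓝[Ici T] T, h (Y n t) ≤ Y (n + 1) t := by
    intro n hn
    obtain ⟨hn1, hnN⟩ := hmemI hn
    by_cases hxδ : Y n T < 1 / 10
    · -- flat bottom piece: `h ≡ 0` and positivity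
      have ev1 : ∀ᶠ t in 𝓝[Ici T] T, Y n t < 1 / 10 := (hcw n (by omega)).eventually_lt_const hxδ
      filter_upwards [ev1, self_mem_nhdsWithin] with t ht hTt
      rw [hh]; dsimp only; rw [if_pos ht.le]
      exact hpos (n + 1) (by omega) t (hT0.trans hTt)
    · push Not at hxδ
      rcases lt_or_eq_of_le (hBot' n hn1 hnN) with hlt | heq
      · have hc2 : ContinuousWithinAt (fun t => h (Y n t) - Y (n + 1) t) (Ici T) T :=
          (((continuous_lowerCurve c).continuousAt).comp_continuousWithinAt (hcw n (by omega))).sub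
            (hcw (n + 1) (by omega))
        have hlt' : h (Y n T) - Y (n + 1) T < 0 := by linarith
        exact (hc2.eventually_lt_const hlt').mono fun t ht => by linarith
      · -- active constraint on the curved bottom piece
        have hdn := hd n hn1 (by omega)
        have hdn1 := hd (n + 1) (by omega) hnN
        simp only [Nat.add_sub_cancel] at hdn1
        have hchain := (hasDerivAt_lowerCurve c (Y n T)).comp_hasDerivWithinAt T hdn
        have hφ := hchain.sub hdn1
        have h0 : h (Y n T) - Y (n + 1) T ≤ 0 := by rw [heq]; simp
        rcases eq_or_lt_of_le hxδ with hxeq | hxgt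
        · -- the corner `x = δ`: `h = h' = 0`, `Y_{n+1} = 0`
          have hy0 : Y (n + 1) T = 0 := by
            rw [← heq, hh]; dsimp only; rw [if_pos hxeq.symm.le]
          have hneg : (if Y n T ≤ 1 / 10 then (0 : ℝ)
                else 4 * c * ((Y n T - 1 / 10) / (9 / 10)) ^ 3 / (9 / 10)) *
                (-κ n * Y n T + F n * (Y (n - 1) T ^ 2 - p * Y n T * Y (n + 1) T)) -
              (-κ (n + 1) * Y (n + 1) T +
                F (n + 1) * (Y n T ^ 2 - p * Y (n + 1) T * Y (n + 1 + 1) T)) < 0 := by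
            rw [if_pos hxeq.symm.le, hy0, ← hxeq]
            exact bottom_corner_deriv_neg (hF (n + 1))
          exact (eventually_nonpos_of_hasDerivWithinAt_neg hφ hneg h0).mono fun t ht => by
            simpa [Function.comp, hh] using ht
        · -- `x > δ`: piece `n₅`
          have hy : Y (n + 1) T = c * ((Y n T - 1 / 10) / (9 / 10)) ^ 4 := by
            rw [← heq, hh]; dsimp only; rw [if_neg (not_le.2 hxgt)]
          have hx1 : Y n T ≤ 1 := hR' n hn1 (by omega)
          have hzupp := hupp (n + 1) (by omega) hnN
          have hneg : (if Y n T ≤ 1 / 10 then (0 : ℝ)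
                else 4 * c * ((Y n T - 1 / 10) / (9 / 10)) ^ 3 / (9 / 10)) *
                (-κ n * Y n T + F n * (Y (n - 1) T ^ 2 - p * Y n T * Y (n + 1) T)) -
              (-κ (n + 1) * Y (n + 1) T +
                F (n + 1) * (Y n T ^ 2 - p * Y (n + 1) T * Y (n + 1 + 1) T)) < 0 := by
            rw [if_neg (not_le.2 hxgt), hFL n]
            have := bottom_curve_deriv_neg (hκ n).le (hκ4 n) (hF n) hp hpc hL hcb hLc hxgt.le hx1
              hy hzupp (hposT (n - 1) (by omega)) (hle1 (n - 1) (by omega))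
            convert this using 2
          exact (eventually_nonpos_of_hasDerivWithinAt_neg hφ hneg h0).mono fun t ht => by
            simpa [Function.comp, hh] using ht
  ------------------------------------------------------------------
  -- exit: `P` holds eventually at `T` within `[0, b]`, contradicting `T < b`
  ------------------------------------------------------------------
  have hright : ∀ᶠ t in 𝓝[Ici T] T, P t := by
    have e1 := (Filter.eventually_all_finset _).2 evR
    have e2 := (Filter.eventually_all_finset _).2 evT
    have e3 := (Filter.eventually_all_finset _).2 evB
    filter_upwards [e1, e2, e3] with t h1 h2 h3
    simp only [hP]
    exact ⟨h1, h2, h3⟩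
  exact Literature.Analysis.ODE.not_eventually_of_maximalTimeP_lt hb.le hP0 hTb
    (eventually_nhdsWithin_Icc_of_left_of_right hPT hright)

end Literature.Barriers.NavierStokesRegularity.Dyadic
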